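import Mathlib
import HarnessLib.Audit
import Summits.PneNP.PneNP.Theorems.PstarCross2

/-!
# The BLIND free cross gate is OR-shaped: `w₁ = R + (x_p ∨ x_q)` (ROUND-25, memo §14.31 (IIa) / §14.33 (B), step (1) — the fibre lemma)

FRONTIER range-avoidance ladder, rung F-N3, ROUND 25 (cell `pnp-ideate`, planner memo `r24/CORE-BOUND-NOTES.md` §14.31/§14.33; restricted-model proof complexity —
nothing here bears on `P` versus `NP`).

Setting of `PstarCross2.TerminalFiveCross1Blind`: a terminal pair `(w₁, w₂)` on `J₀`, one cross gate `g₀ = x_p · x_q` among the monomials of `w₁` (`p, q` privates of the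
chords `e_p ≠ e_q`), every other monomial hun-clean, `w₂` reading no private of `e_p, e_q`, and both `p, q` FREE on `Z = Sol_y(J₀) ∩ {w₂ = t₂}`.  On `Z` the private
pair `(x_v, x_{v'})` of a chord whose monomial is OFF moves freely through the three product-zero positions (`PstarUnionAtoms.eval_setPair`) without `w₂` or the other
outputs noticing; comparing `w₁` (which must stay `≠ t₁`) along these moves:

* `or_shape_at` — at a point of `Z` with `x_v = 0` (`v` the gate's variable in the chord `e`, `v'` its mate, `u` the gate's other variable): `v' ∉ w₁.1` and
  `v ∈ w₁.1 ↔ x_u = 1`;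
* `no_double_zero` — no point of `Z` has `x_p = x_q = 0` (else `q ∉ w₁.1` at `x` and `q ∈ w₁.1` at `x` with the pair of `e_p` moved to `(1,0)`);
* hence the OR SHAPE: `p, q ∈ w₁.1`, `p', q' ∉ w₁.1` — `w₁ = R + x_p + x_q + x_p x_q = R + (x_p ∨ x_q)` with `R` blind to the four privates — and `x_p ∨ x_q ≡ 1` on `Z`;
* `TerminalFiveCross1BlindOr` (OPEN, `@[conjecture]`; = memo §14.33 (B)'s datum `D′` kept on `J₀`) — the blind free cross target WITH the OR shape and
  `Z ⊆ {x_p ∨ x_q}` among the hypotheses; **`terminalFiveCross1Blind_of_or : TerminalFiveCross1BlindOr → TerminalFiveCross1Blind`** (proved here).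

What the OR node says in the memo's words: `R ≡ t₁` on `Z`, `Z ⊆ {s_p = 1} ∪ {s_q = 1}`, releases through `R ≠ t₁` or through the corner `s_p = s_q = 0`; target
`#J₀ ≤ 5` (`#(J₀ ∖ {e_p, e_q}) ≤ 3`).
-/

set_option linter.dupNamespace false -- `Summit.PneNP.PneNP.…`: summit = sub-problem name (D-0017 single-conjunct layout)

open Finset Literature.Computability.Complexity
open Summit.PneNP.PneNP.Theorems.PstarFibrePolys (bit bit_injective bit_xor)
open Summit.PneNP.PneNP.Theorems.PstarTyped (Typed)
open Summit.PneNP.PneNP.Theorems.PstarSALevel (varSet bdry BoundaryExpanding SimpleOverlap)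
open Summit.PneNP.PneNP.Theorems.PstarGapPeeling (not_mem_varSet_of_private)
open Summit.PneNP.PneNP.Theorems.PstarCentreFree (vars_mem_varSet)
open Summit.PneNP.PneNP.Theorems.PstarGapOneAll (gval)
open Summit.PneNP.PneNP.Theorems.PstarGConstraint (bit_gval gval_update_of_forall_ne)
open Summit.PneNP.PneNP.Theorems.PstarCoreBound (XorClosed)
open Summit.PneNP.PneNP.Theorems.PstarChordRepair (IsChord)
open Summit.PneNP.PneNP.Theorems.PstarChordBridgeCotree (Peelable)
open Summit.PneNP.PneNP.Theorems.PstarChordBridgeTools (privs mem_privs)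
open Summit.PneNP.PneNP.Theorems.PstarCoreBoundTargets (Terminal)
open Summit.PneNP.PneNP.Theorems.PstarUnion (SatPair)
open Summit.PneNP.PneNP.Theorems.PstarUnionAtoms (eval_setPair)
open Summit.PneNP.PneNP.Theorems.PstarFreshErase (bit_gval_update_lin)
open Summit.PneNP.PneNP.Theorems.PstarChordReadCoupledSplit (gval_erase_mono)
open Summit.PneNP.PneNP.Theorems.PstarCross (CrossGate)
open Summit.PneNP.PneNP.Theorems.PstarCross2 (touchedBy TerminalFiveCross1Blind)

namespace Summit.PneNP.PneNP.Theorems.PstarCrossBlind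

variable {n m : ℕ}

/-! ## Moving the private pair of an OFF chord -/

/-- **Moving an OFF private pair inside `Sol(J₀)`.**  If the chord `e` has privates `{v, v'}` (in either slot order), `x` solves `J₀` and `x_v = 0`, then setting
`(x_v, x_{v'}) := (a, b)` with `a ∧ b = 0` still solves `J₀`. -/
theorem sol_update_pair (I : LocalMap 4 n m) (hI : I.IsPure xorAndPred) {y : Fin m → Bool} {J₀ : Finset (Fin m)} {e : Fin m} (he : e ∈ J₀)
    (hch : IsChord I J₀ e) {v v' : Fin n} (hev : (I.vars e 2 = v ∧ I.vars e 3 = v') ∨ (I.vars e 2 = v' ∧ I.vars e 3 = v))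
    {x : Fin n → Bool} (hx : ∀ j ∈ J₀, I.eval x j = y j) (hxv : x v = false) (a b : Bool) (hab : (a && b) = false) :
    ∀ j ∈ J₀, I.eval (Function.update (Function.update x v a) v' b) j = y j := by
  have h23 : I.vars e 2 ≠ I.vars e 3 := fun h => absurd (hI.2 e h) (by decide)
  rcases hev with ⟨h2, h3⟩ | ⟨h2, h3⟩
  · subst h2 h3
    exact eval_setPair I hI he hch hx (by rw [hxv, Bool.false_and]) a b hab
  · subst h2 h3
    rw [Function.update_comm (Ne.symm h23)]
    exact eval_setPair I hI he hch hx (by rw [hxv, Bool.and_false]) b a (by rw [Bool.and_comm]; exact hab)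

/-! ## The OR shape at one chord -/

/-- **OR SHAPE AT ONE CHORD.**  Let `g₀ ∈ w₁.2.1` be a gate on `{v, u}`, `v` a private of the chord `e` with mate `v'` (`u ∉ {v, v'}`), every other monomial of `w₁` and
all of `w₂` untouched on `v, v'`, and `w₁ ≠ t₁` on `Z`.  At a point `x ∈ Z` with `x_v = 0`: `v' ∉ w₁.1`, and `v ∈ w₁.1 ↔ x_u = 1`. -/
theorem or_shape_at (I : LocalMap 4 n m) (hI : I.IsPure xorAndPred) {y : Fin m → Bool} {J₀ : Finset (Fin m)}
    {w₁ w₂ : Finset (Fin n) × Finset (Fin m) × Bool}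
    (hT3 : ∀ z : Fin n → Bool, (∀ j ∈ J₀, I.eval z j = y j) → gval I w₂.1 w₂.2.1 z = w₂.2.2 → gval I w₁.1 w₁.2.1 z ≠ w₁.2.2)
    {e : Fin m} (he : e ∈ J₀) (hch : IsChord I J₀ e) {v v' u : Fin n} (hev : (I.vars e 2 = v ∧ I.vars e 3 = v') ∨ (I.vars e 2 = v' ∧ I.vars e 3 = v))
    {g₀ : Fin m} (hg₀ : g₀ ∈ w₁.2.1) (hgv : (I.vars g₀ 2 = v ∧ I.vars g₀ 3 = u) ∨ (I.vars g₀ 2 = u ∧ I.vars g₀ 3 = v)) (huv : u ≠ v) (huv' : u ≠ v')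
    (hm₁ : ∀ g ∈ w₁.2.1.erase g₀, I.vars g 2 ≠ v ∧ I.vars g 3 ≠ v ∧ I.vars g 2 ≠ v' ∧ I.vars g 3 ≠ v')
    (hw₂ : v ∉ w₂.1 ∧ v' ∉ w₂.1 ∧ ∀ g ∈ w₂.2.1, I.vars g 2 ≠ v ∧ I.vars g 3 ≠ v ∧ I.vars g 2 ≠ v' ∧ I.vars g 3 ≠ v')
    {x : Fin n → Bool} (hx : ∀ j ∈ J₀, I.eval x j = y j) (hxw : gval I w₂.1 w₂.2.1 x = w₂.2.2) (hxv : x v = false) :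
    v' ∉ w₁.1 ∧ (v ∈ w₁.1 ↔ x u = true) := by
  classical
  have hvv' : v ≠ v' := by
    have h23 : I.vars e 2 ≠ I.vars e 3 := fun h => absurd (hI.2 e h) (by decide)
    rcases hev with ⟨h2, h3⟩ | ⟨h2, h3⟩
    · rw [← h2, ← h3]; exact h23
    · rw [← h2, ← h3]; exact h23.symm
  -- the three product-zero points
  let P : Bool → Bool → (Fin n → Bool) := fun a b => Function.update (Function.update x v a) v' b
  have hPv : ∀ a b, P a b v = a := fun a b => by
    show Function.update (Function.update x v a) v' b v = a
    rw [Function.update_of_ne hvv', Function.update_self]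
  have hPv' : ∀ a b, P a b v' = b := fun a b => by
    show Function.update (Function.update x v a) v' b v' = b
    rw [Function.update_self]
  have hPu : ∀ a b, P a b u = x u := fun a b => by
    show Function.update (Function.update x v a) v' b u = x u
    rw [Function.update_of_ne huv', Function.update_of_ne huv]
  have hPZ : ∀ a b, (a && b) = false → (∀ j ∈ J₀, I.eval (P a b) j = y j) ∧ gval I w₂.1 w₂.2.1 (P a b) = w₂.2.2 := by
    intro a b hab
    refine ⟨sol_update_pair I hI he hch hev hx hxv a b hab, ?_⟩
    show gval I w₂.1 w₂.2.1 (Function.update (Function.update x v a) v' b) = w₂.2.2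
    rw [gval_update_of_forall_ne I _ hw₂.2.1 (fun g hg => ⟨(hw₂.2.2 g hg).2.2.1, (hw₂.2.2 g hg).2.2.2⟩),
      gval_update_of_forall_ne I _ hw₂.1 (fun g hg => ⟨(hw₂.2.2 g hg).1, (hw₂.2.2 g hg).2.1⟩)]
    exact hxw
  -- the value of `w₁` along the move
  have key : ∀ a b, bit (gval I w₁.1 w₁.2.1 (P a b)) = bit (gval I w₁.1 (w₁.2.1.erase g₀) x) +
      (if v ∈ w₁.1 then bit a + bit (x v) else 0) + (if v' ∈ w₁.1 then bit b + bit (x v') else 0) + bit a * bit (x u) := by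
    intro a b
    have hgate : (P a b (I.vars g₀ 2) && P a b (I.vars g₀ 3)) = (a && x u) := by
      rcases hgv with ⟨h2, h3⟩ | ⟨h2, h3⟩
      · rw [h2, h3, hPv, hPu]
      · rw [h2, h3, hPv, hPu, Bool.and_comm]
    rw [gval_erase_mono I w₁.1 w₁.2.1 g₀ (P a b), decide_eq_true hg₀, Bool.true_and, hgate, bit_xor]
    have h1 : bit (gval I w₁.1 (w₁.2.1.erase g₀) (P a b)) = bit (gval I w₁.1 (w₁.2.1.erase g₀) (Function.update x v a)) +
        (if v' ∈ w₁.1 then bit b + bit (x v') else 0) := by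
      show bit (gval I w₁.1 (w₁.2.1.erase g₀) (Function.update (Function.update x v a) v' b)) = _
      rw [bit_gval_update_lin I w₁.1 _ (fun g hg => ⟨(hm₁ g hg).2.2.1, (hm₁ g hg).2.2.2⟩), Function.update_of_ne hvv'.symm]
    have h2 : bit (gval I w₁.1 (w₁.2.1.erase g₀) (Function.update x v a)) = bit (gval I w₁.1 (w₁.2.1.erase g₀) x) +
        (if v ∈ w₁.1 then bit a + bit (x v) else 0) :=
      bit_gval_update_lin I w₁.1 _ (fun g hg => ⟨(hm₁ g hg).1, (hm₁ g hg).2.1⟩) a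
    rw [h1, h2]
    have hband : bit (a && x u) = bit a * bit (x u) := by cases a <;> cases x u <;> rfl
    rw [hband]
  -- `w₁ = ¬t₁` at the three points
  have hval : ∀ a b, (a && b) = false → bit (gval I w₁.1 w₁.2.1 (P a b)) = bit (!w₁.2.2) := by
    intro a b hab
    have h := hT3 (P a b) (hPZ a b hab).1 (hPZ a b hab).2
    congr 1
    revert h; cases gval I w₁.1 w₁.2.1 (P a b) <;> cases w₁.2.2 <;> simp
  have e00 := hval false false rfl
  have e01 := hval false true rfl
  have e10 := hval true false rfl
  rw [key] at e00 e01 e10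
  rw [hxv] at e00 e01 e10
  -- bookkeeping in `𝔽₂`
  have ind : ∀ (P : Prop) [Decidable P] (s : ZMod 2), (if P then s else 0) = (if P then (1 : ZMod 2) else 0) * s := by
    intro P _ s; split_ifs <;> simp
  rw [ind (v ∈ w₁.1), ind (v' ∈ w₁.1)] at e00 e01 e10
  have hcv' : (if v' ∈ w₁.1 then (1 : ZMod 2) else 0) = 0 := by
    have h := e01.trans e00.symm
    generalize (if v ∈ w₁.1 then (1 : ZMod 2) else 0) = cv at h
    generalize (if v' ∈ w₁.1 then (1 : ZMod 2) else 0) = cv' at h ⊢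
    generalize bit (gval I w₁.1 (w₁.2.1.erase g₀) x) = K at h
    generalize bit (x v') = xv' at h
    generalize bit (x u) = xu at h
    revert h; revert cv cv' K xv' xu
    simp only [bit]
    decide
  have hcv : (if v ∈ w₁.1 then (1 : ZMod 2) else 0) = bit (x u) := by
    have h := e10.trans e00.symm
    rw [hcv'] at h
    generalize (if v ∈ w₁.1 then (1 : ZMod 2) else 0) = cv at h ⊢
    generalize bit (gval I w₁.1 (w₁.2.1.erase g₀) x) = K at h
    generalize bit (x v') = xv' at h
    generalize bit (x u) = xu at h ⊢
    revert h; revert cv K xv' xu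
    simp only [bit]
    decide
  constructor
  · intro hv'
    rw [if_pos hv'] at hcv'
    exact one_ne_zero hcv'
  · constructor
    · intro hv
      rw [if_pos hv] at hcv
      revert hcv; cases x u <;> simp [bit]
    · intro hu
      by_contra hv
      rw [if_neg hv, hu] at hcv
      revert hcv; simp [bit]

/-- **No point of `Z` has both gate variables OFF.**  (Same setting, with the chord `e` of `v`; `u` arbitrary off `{v, v'}`.)  At `x ∈ Z` with `x_v = x_u = 0` the OR
shape at `e` gives `v ∉ w₁.1`, and at the point with `e`'s pair moved to `(1, 0)` it gives `v ∈ w₁.1`. -/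
theorem no_double_zero (I : LocalMap 4 n m) (hI : I.IsPure xorAndPred) {y : Fin m → Bool} {J₀ : Finset (Fin m)}
    {w₁ w₂ : Finset (Fin n) × Finset (Fin m) × Bool}
    (hT3 : ∀ z : Fin n → Bool, (∀ j ∈ J₀, I.eval z j = y j) → gval I w₂.1 w₂.2.1 z = w₂.2.2 → gval I w₁.1 w₁.2.1 z ≠ w₁.2.2)
    {e e' : Fin m} (he : e ∈ J₀) (hch : IsChord I J₀ e) (he' : e' ∈ J₀) (hch' : IsChord I J₀ e')
    {v v' u u' : Fin n} (hev : (I.vars e 2 = v ∧ I.vars e 3 = v') ∨ (I.vars e 2 = v' ∧ I.vars e 3 = v))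
    (heu : (I.vars e' 2 = u ∧ I.vars e' 3 = u') ∨ (I.vars e' 2 = u' ∧ I.vars e' 3 = u))
    {g₀ : Fin m} (hg₀ : g₀ ∈ w₁.2.1) (hgv : (I.vars g₀ 2 = v ∧ I.vars g₀ 3 = u) ∨ (I.vars g₀ 2 = u ∧ I.vars g₀ 3 = v))
    (huv : u ≠ v) (huv' : u ≠ v') (hvu' : v ≠ u')
    (hm₁' : ∀ g ∈ w₁.2.1.erase g₀, I.vars g 2 ≠ u ∧ I.vars g 3 ≠ u ∧ I.vars g 2 ≠ u' ∧ I.vars g 3 ≠ u')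
    (hw₂ : v ∉ w₂.1 ∧ v' ∉ w₂.1 ∧ ∀ g ∈ w₂.2.1, I.vars g 2 ≠ v ∧ I.vars g 3 ≠ v ∧ I.vars g 2 ≠ v' ∧ I.vars g 3 ≠ v')
    (hw₂' : u ∉ w₂.1 ∧ u' ∉ w₂.1 ∧ ∀ g ∈ w₂.2.1, I.vars g 2 ≠ u ∧ I.vars g 3 ≠ u ∧ I.vars g 2 ≠ u' ∧ I.vars g 3 ≠ u')
    {x : Fin n → Bool} (hx : ∀ j ∈ J₀, I.eval x j = y j) (hxw : gval I w₂.1 w₂.2.1 x = w₂.2.2) (hxv : x v = false) (hxu : x u = false) :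
    False := by
  have hgu : (I.vars g₀ 2 = u ∧ I.vars g₀ 3 = v) ∨ (I.vars g₀ 2 = v ∧ I.vars g₀ 3 = u) := hgv.symm
  -- at `x`: `u ∉ w₁.1`
  have h1 := (or_shape_at I hI hT3 he' hch' heu hg₀ hgu huv.symm hvu' hm₁' hw₂' hx hxw hxu).2
  have hu0 : u ∉ w₁.1 := fun h => by rw [h1.1 h] at hxv; exact Bool.noConfusion hxv
  -- move the pair of `e` to `(1,0)`: still in `Z`, `x_u` unchanged, `x_v = 1`
  have hvv' : v ≠ v' := by
    have h23 : I.vars e 2 ≠ I.vars e 3 := fun h => absurd (hI.2 e h) (by decide)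
    rcases hev with ⟨h2, h3⟩ | ⟨h2, h3⟩
    · rw [← h2, ← h3]; exact h23
    · rw [← h2, ← h3]; exact h23.symm
  set x' : Fin n → Bool := Function.update (Function.update x v true) v' false with hx'
  have hx'J : ∀ j ∈ J₀, I.eval x' j = y j := sol_update_pair I hI he hch hev hx hxv true false rfl
  have hx'w : gval I w₂.1 w₂.2.1 x' = w₂.2.2 := by
    rw [hx', gval_update_of_forall_ne I _ hw₂.2.1 (fun g hg => ⟨(hw₂.2.2 g hg).2.2.1, (hw₂.2.2 g hg).2.2.2⟩),
      gval_update_of_forall_ne I _ hw₂.1 (fun g hg => ⟨(hw₂.2.2 g hg).1, (hw₂.2.2 g hg).2.1⟩)]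
    exact hxw
  have hx'u : x' u = false := by rw [hx', Function.update_of_ne huv', Function.update_of_ne huv]; exact hxu
  have hx'v : x' v = true := by rw [hx', Function.update_of_ne hvv', Function.update_self]
  have h2 := (or_shape_at I hI hT3 he' hch' heu hg₀ hgu huv.symm hvu' hm₁' hw₂' hx'J hx'w hx'u).2
  exact hu0 (h2.2 hx'v)

/-! ## The OR node and the reduction -/

/-- **TARGET (OPEN): the BLIND free cross gate in OR SHAPE** (memo §14.33 (B), the datum `D′` kept on `J₀`).  As `PstarCross2.TerminalFiveCross1Blind`, plus the
consequences of freeness proved in this file: both gate variables are read LINEARLY by `w₁` and their chord-mates are not (`w₁ = R + (x_p ∨ x_q)`, `R` blind), and no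
point of `Z = Sol_y(J₀) ∩ {w₂ = t₂}` has `x_p = x_q = 0` (so `R ≡ t₁` and `s_p ∨ s_q ≡ 1` on `Z`; releases go through `R ≠ t₁` or through the corner `s_p = s_q = 0`).
Expected bound `#J₀ ≤ 5`, i.e. `#(J₀ ∖ {e_p, e_q}) ≤ 3`.  FRONTIER. -/
@[conjecture] def TerminalFiveCross1BlindOr : Prop :=
  ∀ (n m r : ℕ) (I : LocalMap 4 n m), I.IsPure xorAndPred → Typed I → SimpleOverlap I → BoundaryExpanding r I →
  ∀ (y : Fin m → Bool) (J₀ : Finset (Fin m)) (w₁ w₂ : Finset (Fin n) × Finset (Fin m) × Bool), Terminal I r y J₀ w₁ w₂ →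
    ∀ F ⊆ J₀, Peelable I F → (∀ F', F ⊆ F' → F' ⊆ J₀ → Peelable I F' → F' = F) → (∀ e ∈ J₀ \ F, IsChord I J₀ e) →
    ∀ g₀ ∈ w₁.2.1, CrossGate I J₀ F g₀ →
    (∀ g ∈ (w₁.2.1.erase g₀) ∪ w₂.2.1, ∀ v ∈ privs I (J₀ \ F), I.vars g 2 ≠ v ∧ I.vars g 3 ≠ v) →
    (∀ c : Bool, SatPair I y J₀ (({I.vars g₀ 2} : Finset (Fin n)), (∅ : Finset (Fin m)), c) w₂) →
    (∀ c : Bool, SatPair I y J₀ (({I.vars g₀ 3} : Finset (Fin n)), (∅ : Finset (Fin m)), c) w₂) →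
    (∀ e ∈ touchedBy I J₀ F g₀, I.vars e 2 ∉ w₂.1 ∧ I.vars e 3 ∉ w₂.1) →
    -- the OR shape
    I.vars g₀ 2 ∈ w₁.1 → I.vars g₀ 3 ∈ w₁.1 →
    (∀ e ∈ touchedBy I J₀ F g₀, ∀ s : Fin 4, 2 ≤ s.val → I.vars e s ≠ I.vars g₀ 2 → I.vars e s ≠ I.vars g₀ 3 → I.vars e s ∉ w₁.1) →
    (∀ z : Fin n → Bool, (∀ j ∈ J₀, I.eval z j = y j) → gval I w₂.1 w₂.2.1 z = w₂.2.2 → z (I.vars g₀ 2) = true ∨ z (I.vars g₀ 3) = true) →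
    J₀.card ≤ 5

/-- AND slots are `2` or `3`. -/
private theorem slot_cases (s : Fin 4) (hs : 2 ≤ s.val) : s = 2 ∨ s = 3 := by
  rcases s with ⟨_ | _ | _ | _ | k, hk⟩
  · exact absurd hs (by simp)
  · exact absurd hs (by simp)
  · exact Or.inl rfl
  · exact Or.inr rfl
  · omega

/-- **THE FIBRE LEMMA: the blind free cross target reduces to its OR-shaped form.** -/
theorem terminalFiveCross1Blind_of_or (h : TerminalFiveCross1BlindOr) : TerminalFiveCross1Blind := by
  intro n m r I hI hT hS hB y J₀ w₁ w₂ ht F hF hP hmax hch g₀ hg₀ hcg hun h2 h3 hbl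
  classical
  have hT3 : ∀ z : Fin n → Bool, (∀ j ∈ J₀, I.eval z j = y j) → gval I w₂.1 w₂.2.1 z = w₂.2.2 → gval I w₁.1 w₁.2.1 z ≠ w₁.2.2 :=
    fun z hz hzw h1 => ht.2.2.2.2.2.2.1 ⟨z, hz, h1, hzw⟩
  have hg₀J : g₀ ∉ J₀ := fun h => Finset.disjoint_left.1 ht.2.2.2.1 h hg₀
  -- the two chords
  have hpq : I.vars g₀ 2 ≠ I.vars g₀ 3 := fun h => absurd (hI.2 g₀ h) (by decide)
  obtain ⟨e_p, hep, hepv⟩ := (mem_privs I).1 hcg.1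
  obtain ⟨e_q, heq, heqv⟩ := (mem_privs I).1 hcg.2
  have hepJ : e_p ∈ J₀ := (mem_sdiff.1 hep).1
  have heqJ : e_q ∈ J₀ := (mem_sdiff.1 heq).1
  -- a private belongs to one chord only: `u ∈ varSet e`, `u` private of `e'` ⟹ `e = e'`
  have owner : ∀ {e e' : Fin m}, e ∈ J₀ \ F → e' ∈ J₀ \ F → ∀ {u : Fin n}, u ∈ varSet I e → (I.vars e' 2 = u ∨ I.vars e' 3 = u) → e = e' := by
    intro e e' he he' u hu hu'
    by_contra hne
    rcases hu' with h' | h'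
    · exact not_mem_varSet_of_private I (mem_sdiff.1 he').1 (mem_sdiff.1 he).1 hne (hch e' he').1 (vars_mem_varSet I e' 2) (h' ▸ hu)
    · exact not_mem_varSet_of_private I (mem_sdiff.1 he').1 (mem_sdiff.1 he).1 hne (hch e' he').2 (vars_mem_varSet I e' 3) (h' ▸ hu)
  have hvs : ∀ {e : Fin m} {w : Fin n}, (I.vars e 2 = w ∨ I.vars e 3 = w) → w ∈ varSet I e := by
    rintro e w (h | h) <;> rw [← h] <;> exact vars_mem_varSet I e _
  -- `e_p ≠ e_q` (simple overlaps: `g₀` would share two variables with the chord)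
  have hne : e_p ≠ e_q := by
    intro hee
    have h2 : ({(I.vars g₀ 2), (I.vars g₀ 3)} : Finset (Fin n)) ⊆ varSet I g₀ ∩ varSet I e_p := by
      intro w hw
      rw [mem_insert, mem_singleton] at hw
      rw [mem_inter]
      rcases hw with rfl | rfl
      · exact ⟨vars_mem_varSet I g₀ 2, hvs hepv⟩
      · exact ⟨vars_mem_varSet I g₀ 3, hee ▸ hvs heqv⟩
    have hcard := (card_le_card h2).trans (hS g₀ e_p (fun h => hg₀J (h ▸ hepJ)))
    rw [card_pair hpq] at hcard
    omega
  -- mates and slot bookkeeping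
  obtain ⟨p', hevp⟩ : ∃ p', (I.vars e_p 2 = (I.vars g₀ 2) ∧ I.vars e_p 3 = p') ∨ (I.vars e_p 2 = p' ∧ I.vars e_p 3 = (I.vars g₀ 2)) := by
    rcases hepv with h | h
    · exact ⟨I.vars e_p 3, Or.inl ⟨h, rfl⟩⟩
    · exact ⟨I.vars e_p 2, Or.inr ⟨rfl, h⟩⟩
  obtain ⟨q', hevq⟩ : ∃ q', (I.vars e_q 2 = (I.vars g₀ 3) ∧ I.vars e_q 3 = q') ∨ (I.vars e_q 2 = q' ∧ I.vars e_q 3 = (I.vars g₀ 3)) := by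
    rcases heqv with h | h
    · exact ⟨I.vars e_q 3, Or.inl ⟨h, rfl⟩⟩
    · exact ⟨I.vars e_q 2, Or.inr ⟨rfl, h⟩⟩
  have hp'v : I.vars e_p 2 = p' ∨ I.vars e_p 3 = p' := by
    rcases hevp with ⟨-, h⟩ | ⟨h, -⟩
    · exact Or.inr h
    · exact Or.inl h
  have hq'v : I.vars e_q 2 = q' ∨ I.vars e_q 3 = q' := by
    rcases hevq with ⟨-, h⟩ | ⟨h, -⟩
    · exact Or.inr h
    · exact Or.inl h
  have hp'priv : p' ∈ privs I (J₀ \ F) := (mem_privs I).2 ⟨e_p, hep, hp'v⟩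
  have hq'priv : q' ∈ privs I (J₀ \ F) := (mem_privs I).2 ⟨e_q, heq, hq'v⟩
  have hvs_p := hvs hepv
  have hvs_p' := hvs hp'v
  have hvs_q := hvs heqv
  -- distinctness: variables of different chords' private pairs
  have hqp : (I.vars g₀ 3) ≠ (I.vars g₀ 2) := hpq.symm
  have hqp' : (I.vars g₀ 3) ≠ p' := fun h => hne (owner hep heq (by rw [h]; exact hvs_p') heqv)
  have hpq' : (I.vars g₀ 2) ≠ q' := fun h => hne (owner hep heq (by rw [← h]; exact hvs_p) hq'v)
  have hp'q' : p' ≠ q' := fun h => hne (owner hep heq (by rw [← h]; exact hvs_p') hq'v)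
  -- cleanliness of the other monomials and of `w₂` on the four privates
  have clean : ∀ {a a' : Fin n}, a ∈ privs I (J₀ \ F) → a' ∈ privs I (J₀ \ F) →
      (∀ g ∈ w₁.2.1.erase g₀, I.vars g 2 ≠ a ∧ I.vars g 3 ≠ a ∧ I.vars g 2 ≠ a' ∧ I.vars g 3 ≠ a') ∧
      (∀ g ∈ w₂.2.1, I.vars g 2 ≠ a ∧ I.vars g 3 ≠ a ∧ I.vars g 2 ≠ a' ∧ I.vars g 3 ≠ a') := by
    intro a a' ha ha'
    refine ⟨fun g hg => ?_, fun g hg => ?_⟩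
    · have h1 := hun g (mem_union_left _ hg) a ha
      have h2 := hun g (mem_union_left _ hg) a' ha'
      exact ⟨h1.1, h1.2, h2.1, h2.2⟩
    · have h1 := hun g (mem_union_right _ hg) a ha
      have h2 := hun g (mem_union_right _ hg) a' ha'
      exact ⟨h1.1, h1.2, h2.1, h2.2⟩
  have htouch : ∀ {e : Fin m}, e ∈ J₀ \ F → (I.vars e 2 = (I.vars g₀ 2) ∨ I.vars e 3 = (I.vars g₀ 2)) ∨ (I.vars e 2 = (I.vars g₀ 3) ∨ I.vars e 3 = (I.vars g₀ 3)) → e ∈ touchedBy I J₀ F g₀ := by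
    intro e he h
    unfold touchedBy
    refine mem_filter.2 ⟨he, ?_⟩
    rcases h with (h | h) | (h | h)
    · exact Or.inl h.symm
    · exact Or.inr (Or.inl h.symm)
    · exact Or.inr (Or.inr (Or.inl h.symm))
    · exact Or.inr (Or.inr (Or.inr h.symm))
  have hblp := hbl e_p (htouch hep (Or.inl hepv))
  have hblq := hbl e_q (htouch heq (Or.inr heqv))
  have hw₂p : (I.vars g₀ 2) ∉ w₂.1 ∧ p' ∉ w₂.1 ∧ ∀ g ∈ w₂.2.1, I.vars g 2 ≠ (I.vars g₀ 2) ∧ I.vars g 3 ≠ (I.vars g₀ 2) ∧ I.vars g 2 ≠ p' ∧ I.vars g 3 ≠ p' := by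
    refine ⟨?_, ?_, (clean hcg.1 hp'priv).2⟩
    · rcases hevp with ⟨h, -⟩ | ⟨-, h⟩
      · rw [← h]; exact hblp.1
      · rw [← h]; exact hblp.2
    · rcases hp'v with h | h
      · rw [← h]; exact hblp.1
      · rw [← h]; exact hblp.2
  have hw₂q : (I.vars g₀ 3) ∉ w₂.1 ∧ q' ∉ w₂.1 ∧ ∀ g ∈ w₂.2.1, I.vars g 2 ≠ (I.vars g₀ 3) ∧ I.vars g 3 ≠ (I.vars g₀ 3) ∧ I.vars g 2 ≠ q' ∧ I.vars g 3 ≠ q' := by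
    refine ⟨?_, ?_, (clean hcg.2 hq'priv).2⟩
    · rcases hevq with ⟨h, -⟩ | ⟨-, h⟩
      · rw [← h]; exact hblq.1
      · rw [← h]; exact hblq.2
    · rcases hq'v with h | h
      · rw [← h]; exact hblq.1
      · rw [← h]; exact hblq.2
  have hm₁p := (clean hcg.1 hp'priv).1
  have hm₁q := (clean hcg.2 hq'priv).1
  have hgpq : (I.vars g₀ 2 = (I.vars g₀ 2) ∧ I.vars g₀ 3 = (I.vars g₀ 3)) ∨ (I.vars g₀ 2 = (I.vars g₀ 3) ∧ I.vars g₀ 3 = (I.vars g₀ 2)) := Or.inl ⟨rfl, rfl⟩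
  have hgqp : (I.vars g₀ 2 = (I.vars g₀ 3) ∧ I.vars g₀ 3 = (I.vars g₀ 2)) ∨ (I.vars g₀ 2 = (I.vars g₀ 2) ∧ I.vars g₀ 3 = (I.vars g₀ 3)) := Or.inr ⟨rfl, rfl⟩
  -- no point of `Z` with both gate variables OFF
  have hZor : ∀ z : Fin n → Bool, (∀ j ∈ J₀, I.eval z j = y j) → gval I w₂.1 w₂.2.1 z = w₂.2.2 → z (I.vars g₀ 2) = true ∨ z (I.vars g₀ 3) = true := by
    intro z hz hzw
    by_contra hno
    rw [not_or, Bool.not_eq_true, Bool.not_eq_true] at hno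
    exact no_double_zero I hI hT3 hepJ (hch e_p hep) heqJ (hch e_q heq) hevp hevq hg₀ hgpq hqp hqp' hpq' hm₁q hw₂p hw₂q
      hz hzw hno.1 hno.2
  -- the OR shape from the free points
  obtain ⟨zp, hzpJ, hzp0, hzpw⟩ := h2 false
  obtain ⟨zq, hzqJ, hzq0, hzqw⟩ := h3 false
  have hzp : zp (I.vars g₀ 2) = false := by
    have h : gval I {(I.vars g₀ 2)} ∅ zp = false := hzp0
    rwa [PstarChordReadShared.gval_singleton] at h
  have hzq : zq (I.vars g₀ 3) = false := by
    have h : gval I {(I.vars g₀ 3)} ∅ zq = false := hzq0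
    rwa [PstarChordReadShared.gval_singleton] at h
  have hzpq : zp (I.vars g₀ 3) = true := (hZor zp hzpJ hzpw).resolve_left (by rw [hzp]; exact Bool.false_ne_true)
  have hzqp : zq (I.vars g₀ 2) = true := (hZor zq hzqJ hzqw).resolve_right (by rw [hzq]; exact Bool.false_ne_true)
  obtain ⟨hp'C, hpC⟩ := or_shape_at I hI hT3 hepJ (hch e_p hep) hevp hg₀ hgpq hqp hqp' hm₁p hw₂p hzpJ hzpw hzp
  obtain ⟨hq'C, hqC⟩ := or_shape_at I hI hT3 heqJ (hch e_q heq) hevq hg₀ hgqp hpq hpq' hm₁q hw₂q hzqJ hzqw hzq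
  refine h n m r I hI hT hS hB y J₀ w₁ w₂ ht F hF hP hmax hch g₀ hg₀ hcg hun h2 h3 hbl (hpC.2 hzpq) (hqC.2 hzqp) ?_ hZor
  -- the mates are unread
  intro e he s hs hsp hsq
  have heJF : e ∈ J₀ \ F := by unfold touchedBy at he; exact (mem_filter.1 he).1
  have hor : (I.vars e 2 = (I.vars g₀ 2) ∨ I.vars e 3 = (I.vars g₀ 2)) ∨ (I.vars e 2 = (I.vars g₀ 3) ∨ I.vars e 3 = (I.vars g₀ 3)) := by
    unfold touchedBy at he
    rcases (mem_filter.1 he).2 with h | h | h | h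
    · exact Or.inl (Or.inl h.symm)
    · exact Or.inl (Or.inr h.symm)
    · exact Or.inr (Or.inl h.symm)
    · exact Or.inr (Or.inr h.symm)
  rcases hor with h | h
  · have hee : e = e_p := (owner hep heJF hvs_p h).symm
    subst hee
    have : I.vars e s = p' := by
      rcases slot_cases s hs with rfl | rfl
      · rcases hevp with ⟨h2', -⟩ | ⟨h2', -⟩
        · exact absurd h2' hsp
        · exact h2'
      · rcases hevp with ⟨-, h3'⟩ | ⟨-, h3'⟩
        · exact h3'
        · exact absurd h3' hsp
    rw [this]; exact hp'C
  · have hee : e = e_q := (owner heq heJF hvs_q h).symm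
    subst hee
    have : I.vars e s = q' := by
      rcases slot_cases s hs with rfl | rfl
      · rcases hevq with ⟨h2', -⟩ | ⟨h2', -⟩
        · exact absurd h2' hsq
        · exact h2'
      · rcases hevq with ⟨-, h3'⟩ | ⟨-, h3'⟩
        · exact h3'
        · exact absurd h3' hsq
    rw [this]; exact hq'C

end Summit.PneNP.PneNP.Theorems.PstarCrossBlind
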